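import Summits.HodgeConjecture.CorCM.GaloisIndexTwoTimesCyclicAllDegrees
import HarnessLib

/-!
# The easy half with an INVERTED cyclic factor: `x` inverting `ℤ/n ⊆ A` (`n ≥ 7`) ⟹ BAD — the twin of `GaloisIndexTwoTimesCyclicAllDegrees`

COR-CM (cell `pub-hodgecm2`), binder seat b04 (gen 30), count-neutral own lane «Galois-CM-type classification» (which Galois CM
fields `(G, c)` have ALL primitive CM types nondegenerate = GOOD, vs. a primitive degenerate type = BAD).  KERNEL ONLY: theorems;
no definition, no named fact, no `sorry`.  `HC_CM` is neither used nor claimed.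

SETTING.  `G₀ = i(A) ⊔ i(A)x`, `A = B × ℤ/n` abelian of index two, complex conjugation `c = (c_B, 0)`, `x² = i(q)` with `c ∉ ⟨q⟩`
(the EASY side of `CorCM/GaloisIndexTwoDoubledTypes`).  In `CorCM/GaloisIndexTwoTimesCyclicAllDegrees` the element `x` CENTRALISES
the factor `ℤ/n` (`θ = θ_B × id`, `n ≥ 3`, `θ_B ≠ id`).  Here `x` INVERTS it: **`θ = θ_B × (−1)`** — the groups `C_n ⋊ Γ₀` in which
the non-`A₀` coset of `Γ₀` acts on `C_n` by inversion (`C_p ⋊ D₄` with Klein kernel, `C_p ⋊ SD₁₆`, `C_p ⋊ M₁₆`, `C_p ⋊ Pauli`,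
`C_p ⋊ (C₄ ⋊ C₄)`, `C₄ × D_n`, `Dih(B × C_n)`, …), with NO condition on `θ_B`.

THE HALF (size-graded fibres over `B`; §1).  Fix a half `H₀ ∋ 0` of `(B, c)` and `E = {0, 1, 3} ⊂ ℤ/n`; put
`S = {(b, z) : z ∈ F_b}` with `F_0 = {0}`, `F_b = E` (`b ∈ H₀ ∖ 0`), and complementary fibres over `c + H₀` (`F_c = ℤ/n ∖ 0`,
`F_b = ℤ/n ∖ E` otherwise).  For `n ≥ 7`: `S` is a CM half (`graded_cm`); APERIODIC (`graded_aperiodic`: `F_0` is the only singleton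
fibre and every other fibre has two distinct points — explicit witnesses); and `θ`-ASYMMETRIC for `θ = θ_B × (−1)` with ANY map
`θ_B` fixing `0` and `c` and injective (`graded_asymmetric`: a symmetry `(β, w)` is forced to `(0, 0)` by the singleton fibre, and
then a point `b₀ ∈ H₀ ∖ 0` compares `E` with `−F_{θ b₀}`: `−1 ∉ E` resp. `0 ∈ E`).  Only the constants `0, ±1, 2, 3, 4 ∈ ℤ/n` and their
distinctness (`n ≥ 7`) enter; no cardinalities.

THEOREM (§2 **`exists_simple_degenerate_of_index_two_inverted_cyclic`**).  `K` Galois CM, `e : Gal(K/ℚ) ≃* G₀`,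
`i : B × ℤ/n ↪ G₀` abelian of index two with `n ≥ 7` and `|B| > 2`, `x i(b, v) = i(θ_B b, −v) x`, `x² = i(q)`, complex conjugation
`e(c̄) = i(c, 0)` with `(c, 0) ∉ ⟨q⟩` ⟹ `K` carries a SIMPLE DEGENERATE abelian variety of dimension `|G₀|/2` with CM by `K`
(rational `(p,p)` class outside the divisor ring on some power).  Consistency: the HARD side is excluded (`C_p ⋊ C₈`, `Dic_{2p}` —
GOOD cases — have `c ∈ ⟨x²⟩`), and `|B| = 2` is excluded (`C₂ × D₃` is GOOD); `C_p ⋊ D₄` for `p ≥ 7` is recovered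
(`CorCM/GaloisCyclicSemidirectDihedralFourDegenerate` did `p ≥ 5` by hand).

## References

* [Kubota1965] T. Kubota, *On the field extension by complex multiplication*, Trans. AMS 118 (1965), §2, §4 Lemma 2.
* [Shimura1998] G. Shimura, *Abelian Varieties with Complex Multiplication and Modular Functions*, §6.2 Thm. 3, §8.2 Prop. 26.
* [Gordon1999HodgeAVSurvey] B. B. Gordon, *A survey of the Hodge conjecture for abelian varieties*, Thm. 6.4, §9.3.
-/

noncomputable section

open CategoryTheory CategoryTheory.Limits NumberField
open scoped BigOperators symmDiff

namespace Summit.HodgeConjecture.CorCM.SplitInvolution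

open Literature.NumberTheory.ComplexMultiplication
open Literature.AlgebraicGeometry.Motives (AbelianVariety CMType)
open Literature.AlgebraicGeometry.HodgeTheory
open Literature.AlgebraicGeometry.ComplexMultiplication (IsCMTypeRealisation)
open Literature.AlgebraicGeometry.Pohlmann1968
open Literature.Barriers.HodgeConjecture (divisorClassesSpan)
open Summit.HodgeConjecture.CorCM.GaloisRank (model_complexConj_mul_self model_complexConj_comm)

namespace InvertedCyclic

/-! ## §1 The size-graded half of `B × ℤ/n` -/

section Half

variable {B : Type*} [AddCommGroup B] [DecidableEq B] {n : ℕ}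
variable (H₀ : Finset B) (c : B) (S : Finset (Multiplicative B × Multiplicative (ZMod n)))
  (hH₀ : ∀ b, b ∈ H₀ ↔ c + b ∉ H₀) (h0 : (0 : B) ∈ H₀)
  (hSmem : ∀ (b : B) (z : ZMod n), (Multiplicative.ofAdd b, Multiplicative.ofAdd z) ∈ S ↔
    (if b ∈ H₀ then (if b = 0 then z = 0 else (z = 0 ∨ z = 1 ∨ z = 3))
      else (if b = c then ¬ z = 0 else ¬ (z = 0 ∨ z = 1 ∨ z = 3))))

omit [DecidableEq B] in
/-- Products of coordinate points. [folklore] -/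
theorem mul_pt (β : B) (w : ZMod n) (b : B) (y : ZMod n) :
    ((Multiplicative.ofAdd β, Multiplicative.ofAdd w) : Multiplicative B × Multiplicative (ZMod n)) *
        (Multiplicative.ofAdd b, Multiplicative.ofAdd y) = (Multiplicative.ofAdd (β + b), Multiplicative.ofAdd (w + y)) := by
  rw [Prod.mk_mul_mk, ← ofAdd_add, ← ofAdd_add]

include hH₀ h0 in
omit [DecidableEq B] in
/-- `c ∉ H₀` and `c ≠ 0`. [folklore] -/
theorem c_facts : c ∉ H₀ ∧ c ≠ 0 := by
  have h := (hH₀ 0).1 h0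
  rw [add_zero] at h
  exact ⟨h, fun hc => h (hc ▸ h0)⟩

include hSmem h0 in
/-- The fibre over `0` is `{0}`. [folklore] -/
theorem mem_zero (z : ZMod n) :
    ((Multiplicative.ofAdd (0 : B), Multiplicative.ofAdd z) : Multiplicative B × Multiplicative (ZMod n)) ∈ S ↔ z = 0 := by
  rw [hSmem, if_pos h0, if_pos rfl]

include hSmem in
/-- The fibre over `b ∈ H₀ ∖ 0` is `E = {0, 1, 3}`. [folklore] -/
theorem mem_H {b : B} (hb : b ∈ H₀) (hb0 : b ≠ 0) (z : ZMod n) :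
    ((Multiplicative.ofAdd b, Multiplicative.ofAdd z) : Multiplicative B × Multiplicative (ZMod n)) ∈ S ↔
      (z = 0 ∨ z = 1 ∨ z = 3) := by
  rw [hSmem, if_pos hb, if_neg hb0]

include hSmem hH₀ h0 in
/-- The fibre over `c` is `ℤ/n ∖ 0`. [folklore] -/
theorem mem_c (z : ZMod n) :
    ((Multiplicative.ofAdd c, Multiplicative.ofAdd z) : Multiplicative B × Multiplicative (ZMod n)) ∈ S ↔ ¬ z = 0 := by
  rw [hSmem, if_neg (c_facts H₀ c hH₀ h0).1, if_pos rfl]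

include hSmem in
/-- The fibre over `b ∉ H₀`, `b ≠ c` is `ℤ/n ∖ E`. [folklore] -/
theorem mem_out {b : B} (hb : b ∉ H₀) (hbc : b ≠ c) (z : ZMod n) :
    ((Multiplicative.ofAdd b, Multiplicative.ofAdd z) : Multiplicative B × Multiplicative (ZMod n)) ∈ S ↔
      ¬ (z = 0 ∨ z = 1 ∨ z = 3) := by
  rw [hSmem, if_neg hb, if_neg hbc]

include hSmem hH₀ h0 in
/-- **CM**: the graded set is a CM half for `(c, 0)` (`2c = 0`). [folklore] -/
theorem graded_cm (hcc : c + c = 0) (a : Multiplicative B × Multiplicative (ZMod n)) :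
    a ∈ S ↔ ((Multiplicative.ofAdd c, (1 : Multiplicative (ZMod n))) : Multiplicative B × Multiplicative (ZMod n)) * a ∉ S := by
  obtain ⟨hcH, hc0⟩ := c_facts H₀ c hH₀ h0
  obtain ⟨u, v⟩ := a
  have e1 : ((u, v) : Multiplicative B × Multiplicative (ZMod n)) =
      (Multiplicative.ofAdd (Multiplicative.toAdd u), Multiplicative.ofAdd (Multiplicative.toAdd v)) := by
    rw [ofAdd_toAdd, ofAdd_toAdd]
  rw [e1, show ((Multiplicative.ofAdd c, (1 : Multiplicative (ZMod n))) : Multiplicative B × Multiplicative (ZMod n)) =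
    (Multiplicative.ofAdd c, Multiplicative.ofAdd 0) by rw [ofAdd_zero], mul_pt, zero_add]
  set b := Multiplicative.toAdd u
  set z := Multiplicative.toAdd v
  by_cases hb : b ∈ H₀
  · by_cases hb0 : b = 0
    · rw [hb0, add_zero, mem_zero H₀ c S h0 hSmem, mem_c H₀ c S hH₀ h0 hSmem, not_not]
    · have hcb : c + b ∉ H₀ := (hH₀ b).1 hb
      have hcbc : c + b ≠ c := fun h => hb0 (by simpa using h)
      rw [mem_H H₀ c S hSmem hb hb0, mem_out H₀ c S hSmem hcb hcbc, not_not]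
  · have hcb : c + b ∈ H₀ := by
      by_contra h
      have h' := (hH₀ (c + b)).2 (by rwa [← add_assoc, hcc, zero_add])
      exact h h'
    by_cases hbc : b = c
    · rw [hbc, hcc, mem_zero H₀ c S h0 hSmem, mem_c H₀ c S hH₀ h0 hSmem]
    · have hcb0 : c + b ≠ 0 := fun h => hbc (by
        have e : b = -c := eq_neg_of_add_eq_zero_right h
        rwa [neg_eq_of_add_eq_zero_right hcc] at e)
      rw [mem_out H₀ c S hSmem hb hbc, mem_H H₀ c S hSmem hcb hcb0]

/-- Small constants of `ℤ/n`, `n ≥ 7`. [folklore] -/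
theorem consts (hn : 7 ≤ n) :
    (1 : ZMod n) ≠ 0 ∧ (2 : ZMod n) ≠ 0 ∧ (3 : ZMod n) ≠ 0 ∧ (4 : ZMod n) ≠ 0 ∧ (2 : ZMod n) ≠ 1 ∧ (2 : ZMod n) ≠ 3 ∧
      (4 : ZMod n) ≠ 1 ∧ (4 : ZMod n) ≠ 3 ∧ (4 : ZMod n) ≠ 2 ∧ (-1 : ZMod n) ≠ 0 ∧ (-1 : ZMod n) ≠ 1 ∧ (-1 : ZMod n) ≠ 3 := by
  have hk : ∀ k : ℕ, 0 < k → k < 7 → ((k : ℕ) : ZMod n) ≠ 0 := by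
    intro k hk0 hk7 h
    rw [ZMod.natCast_eq_zero_iff] at h
    exact absurd (Nat.le_of_dvd hk0 h) (by omega)
  have h1 : (1 : ZMod n) ≠ 0 := by exact_mod_cast hk 1 (by norm_num) (by norm_num)
  have h2 : (2 : ZMod n) ≠ 0 := by exact_mod_cast hk 2 (by norm_num) (by norm_num)
  have h3 : (3 : ZMod n) ≠ 0 := by exact_mod_cast hk 3 (by norm_num) (by norm_num)
  have h4 : (4 : ZMod n) ≠ 0 := by exact_mod_cast hk 4 (by norm_num) (by norm_num)
  refine ⟨h1, h2, h3, h4, fun h => h1 (by linear_combination h), fun h => h1 (by linear_combination -h),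
    fun h => h3 (by linear_combination h), fun h => h1 (by linear_combination h), fun h => h2 (by linear_combination h),
    fun h => h1 (by linear_combination -h), fun h => h2 (by linear_combination -h), fun h => h4 (by linear_combination -h)⟩

include hSmem hH₀ h0 in
/-- Every fibre other than `F_0` has, next to any of its points `w`, a second point `w' ≠ w`. [folklore] -/
theorem exists_second_point (hn : 7 ≤ n) {β : B} (hβ : β ≠ 0) (w : ZMod n) :
    ∃ w' : ZMod n, w' ≠ w ∧
      ((Multiplicative.ofAdd β, Multiplicative.ofAdd w') : Multiplicative B × Multiplicative (ZMod n)) ∈ S := by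
  obtain ⟨h1, h2, _, h4, h21, h23, h41, h43, h42, -⟩ := consts hn
  by_cases hβH : β ∈ H₀
  · -- `F_β = E`: `0` and `1`
    by_cases hw0 : w = 0
    · refine ⟨1, by rw [hw0]; exact h1, ?_⟩
      rw [mem_H H₀ c S hSmem hβH hβ]; exact Or.inr (Or.inl rfl)
    · refine ⟨0, fun h => hw0 h.symm, ?_⟩
      rw [mem_H H₀ c S hSmem hβH hβ]; exact Or.inl rfl
  · by_cases hβc : β = c
    · -- `F_c = ℤ/n ∖ 0`: `1` and `2`
      subst hβc
      by_cases hw1 : w = 1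
      · refine ⟨2, by rw [hw1]; exact h21, ?_⟩
        rw [mem_c H₀ β S hH₀ h0 hSmem]; exact h2
      · refine ⟨1, fun h => hw1 h.symm, ?_⟩
        rw [mem_c H₀ β S hH₀ h0 hSmem]; exact h1
    · -- `F_β = ℤ/n ∖ E`: `2` and `4`
      by_cases hw2 : w = 2
      · refine ⟨4, by rw [hw2]; exact h42, ?_⟩
        rw [mem_out H₀ c S hSmem hβH hβc]
        push Not
        exact ⟨h4, h41, h43⟩
      · refine ⟨2, fun h => hw2 h.symm, ?_⟩
        rw [mem_out H₀ c S hSmem hβH hβc]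
        push Not
        exact ⟨h2, h21, h23⟩

include hSmem hH₀ h0 in
/-- **APERIODIC** (`n ≥ 7`): no `(β, w) ≠ 0` translates the graded half onto itself. [folklore] -/
theorem graded_aperiodic (hn : 7 ≤ n) (β : B) (w : ZMod n) (ha : (β, w) ≠ (0 : B × ZMod n)) :
    ∃ s, ¬ (s ∈ S ↔ ((Multiplicative.ofAdd β, Multiplicative.ofAdd w) : Multiplicative B × Multiplicative (ZMod n)) * s ∈ S) := by
  have h00 := (mem_zero H₀ c S h0 hSmem 0).2 rfl
  by_cases hβ : β = 0
  · -- `β = 0`, `w ≠ 0`: witness `(0, 0)`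
    subst hβ
    have hw : w ≠ 0 := fun h => ha (by rw [h]; rfl)
    refine ⟨(Multiplicative.ofAdd 0, Multiplicative.ofAdd 0), fun h => hw ?_⟩
    have h' := h.1 h00
    rwa [mul_pt, add_zero, add_zero, mem_zero H₀ c S h0 hSmem] at h'
  by_cases hP : ((Multiplicative.ofAdd β, Multiplicative.ofAdd w) : Multiplicative B × Multiplicative (ZMod n)) ∈ S
  · -- `w ∈ F_β`: witness `(0, w' − w)` with `w' ≠ w` in `F_β`
    obtain ⟨w', hw'ne, hw'⟩ := exists_second_point H₀ c S hH₀ h0 hSmem hn hβ w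
    refine ⟨(Multiplicative.ofAdd 0, Multiplicative.ofAdd (w' - w)), fun h => hw'ne ?_⟩
    have h' := h.2 (by rw [mul_pt, add_zero, add_sub_cancel]; exact hw')
    rw [mem_zero H₀ c S h0 hSmem, sub_eq_zero] at h'
    exact h'
  · -- `w ∉ F_β`: witness `(0, 0)`
    refine ⟨(Multiplicative.ofAdd 0, Multiplicative.ofAdd 0), fun h => hP ?_⟩
    have h' := h.1 h00
    rwa [mul_pt, add_zero, add_zero] at h'

include hSmem hH₀ h0 in
/-- **`θ`-ASYMMETRIC** (`n ≥ 7`) for `θ(b, y) = (θ_B b, −y)`, `θ_B` injective fixing `0` and `c`, and `H₀ ∖ 0 ≠ ∅`: no `(β, w)`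
has `(β, w) + θ(S) = S`. [folklore] -/
theorem graded_asymmetric (hn : 7 ≤ n) (θ : B → B) (hθ0 : θ 0 = 0) (hθc : θ c = c) (hθ : Function.Injective θ)
    {b₀ : B} (hb₀ : b₀ ∈ H₀) (hb₀0 : b₀ ≠ 0) (β : B) (w : ZMod n) :
    ∃ s : Multiplicative B × Multiplicative (ZMod n),
      ¬ (s ∈ S ↔ ((Multiplicative.ofAdd β, Multiplicative.ofAdd w) : Multiplicative B × Multiplicative (ZMod n)) *
        (Multiplicative.ofAdd (θ (Multiplicative.toAdd s.1)), s.2⁻¹) ∈ S) := by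
  obtain ⟨h1, -, -, -, -, -, -, -, -, hm0, hm1, hm3⟩ := consts hn
  obtain ⟨hcH, -⟩ := c_facts H₀ c hH₀ h0
  have h00 := (mem_zero H₀ c S h0 hSmem 0).2 rfl
  -- the image of a coordinate point under `θ × (−1)`
  have himg : ∀ (b : B) (y : ZMod n),
      ((Multiplicative.ofAdd (θ (Multiplicative.toAdd ((Multiplicative.ofAdd b, Multiplicative.ofAdd y) :
        Multiplicative B × Multiplicative (ZMod n)).1)), ((Multiplicative.ofAdd b, Multiplicative.ofAdd y) :
          Multiplicative B × Multiplicative (ZMod n)).2⁻¹) : Multiplicative B × Multiplicative (ZMod n)) =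
        (Multiplicative.ofAdd (θ b), Multiplicative.ofAdd (-y)) := fun b y => by
    rw [toAdd_ofAdd, ofAdd_neg]
  by_cases hβw : β = 0 ∧ w = 0
  · -- `(β, w) = (0, 0)`: compare the fibre `E` over `b₀` with `−F_{θ b₀}`
    obtain ⟨rfl, rfl⟩ := hβw
    have hb₁0 : θ b₀ ≠ 0 := fun h => hb₀0 (hθ (by rw [h, hθ0]))
    have hb₁c : θ b₀ ≠ c := fun h => hcH (by rw [← hθ (h.trans hθc.symm)]; exact hb₀)
    by_cases hb₁ : θ b₀ ∈ H₀
    · -- `F_{θ b₀} = E`, `y = 1`: `1 ∈ E` but `−1 ∉ E`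
      refine ⟨(Multiplicative.ofAdd b₀, Multiplicative.ofAdd 1), fun h => ?_⟩
      rw [himg, mul_pt, zero_add, zero_add, mem_H H₀ c S hSmem hb₀ hb₀0, mem_H H₀ c S hSmem hb₁ hb₁0] at h
      have h' := h.1 (Or.inr (Or.inl rfl))
      rcases h' with h' | h' | h'
      · exact hm0 h'
      · exact hm1 h'
      · exact hm3 h'
    · -- `F_{θ b₀} = ℤ/n ∖ E`, `y = 0`: `0 ∈ E` but `−0 = 0 ∈ E`
      refine ⟨(Multiplicative.ofAdd b₀, Multiplicative.ofAdd 0), fun h => ?_⟩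
      rw [himg, mul_pt, zero_add, neg_zero, zero_add, mem_H H₀ c S hSmem hb₀ hb₀0, mem_out H₀ c S hSmem hb₁ hb₁c] at h
      exact (h.1 (Or.inl rfl)) (Or.inl rfl)
  · by_cases hβ : β = 0
    · -- `β = 0`, `w ≠ 0`: `s = (0, 0)`
      subst hβ
      have hw : w ≠ 0 := fun h => hβw ⟨rfl, h⟩
      refine ⟨(Multiplicative.ofAdd 0, Multiplicative.ofAdd 0), fun h => hw ?_⟩
      have h' := h.1 h00
      rwa [himg, mul_pt, hθ0, add_zero, neg_zero, add_zero, mem_zero H₀ c S h0 hSmem] at h'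
    · by_cases hP : ((Multiplicative.ofAdd β, Multiplicative.ofAdd w) : Multiplicative B × Multiplicative (ZMod n)) ∈ S
      · -- `w ∈ F_β`: `s = (0, w − w')`
        obtain ⟨w', hw'ne, hw'⟩ := exists_second_point H₀ c S hH₀ h0 hSmem hn hβ w
        refine ⟨(Multiplicative.ofAdd 0, Multiplicative.ofAdd (w - w')), fun h => hw'ne ?_⟩
        have h' := h.2 (by rw [himg, mul_pt, hθ0, add_zero, neg_sub, add_sub_cancel]; exact hw')
        rw [mem_zero H₀ c S h0 hSmem, sub_eq_zero] at h'
        exact h'.symm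
      · -- `w ∉ F_β`: `s = (0, 0)`
        refine ⟨(Multiplicative.ofAdd 0, Multiplicative.ofAdd 0), fun h => hP ?_⟩
        have h' := h.1 h00
        rwa [himg, mul_pt, hθ0, add_zero, neg_zero, add_zero] at h'

end Half

end InvertedCyclic

/-! ## §2 The theorem -/

section Field

open InvertedCyclic

variable {G₀ : Type*} [Group G₀] [Fintype G₀] [DecidableEq G₀]
variable {B : Type*} [AddCommGroup B] [Fintype B] [DecidableEq B]
variable {K : Type} [Field K] [NumberField K] [IsCMField K] [IsGalois ℚ K]

/-- **THE EASY HALF WITH AN INVERTED CYCLIC FACTOR.**  `K` a Galois CM field, `e : Gal(K/ℚ) ≃* G₀`; `i : B × ℤ/n ↪ G₀` (multiplicative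
notation) abelian of index two with `n ≥ 7` and `|B| > 2`; `x i(b, v) = i(θ b, v⁻¹) x` for an additive automorphism `θ` of `B`
(no further condition); `x² = i(q)`; complex conjugation `e(c̄) = i(c, 0)` with `(c, 0) ∉ ⟨q⟩`.  THEN `K` has a PRIMITIVE
DEGENERATE CM type, realised by a SIMPLE abelian variety of dimension `|G₀|/2` with CM by `K` carrying a rational `(p,p)` class
outside the divisor ring on some power. [cite: Kubota1965, §2 and §4 Lemma 2] [cite: Shimura1998, §6.2 Thm. 3 and §8.2 Prop. 26]
[cite: Gordon1999HodgeAVSurvey, Thm. 6.4 and §9.3] -/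
theorem exists_simple_degenerate_of_index_two_inverted_cyclic {n : ℕ} [NeZero n] (hn : 7 ≤ n) (hB : 2 < Fintype.card B)
    (e : (K ≃ₐ[ℚ] K) ≃* G₀) (i : Multiplicative B × Multiplicative (ZMod n) →* G₀) (hi : Function.Injective i)
    (x : G₀) (hx : ∀ u, i u ≠ x) (hcov : ∀ g : G₀, (∃ u, g = i u) ∨ (∃ u, g = i u * x))
    (θ : B ≃+ B) (hθ : ∀ (b : B) (v : Multiplicative (ZMod n)),
      x * i (Multiplicative.ofAdd b, v) = i (Multiplicative.ofAdd (θ b), v⁻¹) * x)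
    (q : Multiplicative B × Multiplicative (ZMod n)) (hq : x * x = i q) (c : B)
    (hcq : (Multiplicative.ofAdd c, (1 : Multiplicative (ZMod n))) ∉ Subgroup.zpowers q)
    (hc : e ((IsCMField.complexConj K).restrictScalars ℚ) = i (Multiplicative.ofAdd c, 1)) :
    ∃ (Φ : CMType K) (φ₀ : K →+* ℂ) (X : AbelianVariety ℂ) (ι : 𝓞 K →+* End X)
      (ϑ : K →+* Module.End ℂ (complexBetti X.X 1)),
      IsPrimitive (ℂ ≃+* ℂ) Φ.1 φ₀ ∧ ¬ IsNondegenerate Φ ∧ IsCMTypeRealisation Φ X ι ϑ ∧ X.IsSimple ∧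
      X.dim = Fintype.card G₀ / 2 ∧
      ∃ m p : ℕ, ∃ y : complexBetti (⨁ fun _ : Fin m => X).X (2 * p), IsRationalClass y ∧
        IsOfHodgeType (⨁ fun _ : Fin m => X).dim (⨁ fun _ : Fin m => X).X (2 * p) p p y ∧
        y ∉ divisorClassesSpan (⨁ fun _ : Fin m => X).X (⨁ fun _ : Fin m => X).dim p := by
  classical
  set cA : Multiplicative B × Multiplicative (ZMod n) := (Multiplicative.ofAdd c, 1) with hcA_def
  -- `c² = 1`, `c ≠ 0`, `θ c = c`, read off `Gal(K/ℚ)`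
  have hccA : cA * cA = 1 := hi (by rw [map_mul, map_one]; exact model_complexConj_mul_self e hc)
  have hcc : c + c = 0 := by
    have h := congrArg (fun w => Multiplicative.toAdd w.1) hccA
    simpa [hcA_def] using h
  have hc0 : c ≠ 0 := by
    rintro rfl
    exact hcq (by rw [hcA_def, ofAdd_zero, ← Prod.one_eq_mk]; exact one_mem _)
  let θA : Multiplicative B × Multiplicative (ZMod n) ≃* Multiplicative B × Multiplicative (ZMod n) :=
    MulEquiv.prodCongr (AddEquiv.toMultiplicative θ) (MulEquiv.inv _)
  have hθA_apply : ∀ w, θA w = (Multiplicative.ofAdd (θ (Multiplicative.toAdd w.1)), w.2⁻¹) := fun w => rfl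
  have hθ' : ∀ u, x * i u = i (θA u) * x := fun ⟨u, v⟩ => by
    rw [hθA_apply, ← hθ, ofAdd_toAdd]
  have hθc : θ c = c := by
    have h1 : i cA * x = i (θA cA) * x := by rw [← hθ', model_complexConj_comm e hc x]
    have h2 := congrArg (fun w => Multiplicative.toAdd w.1) (hi (mul_right_cancel h1))
    simpa [hcA_def, hθA_apply] using h2.symm
  have hθAc : θA cA = cA := by rw [hθA_apply, hcA_def, toAdd_ofAdd, hθc, inv_one]
  -- a half `H₀ ∋ 0` of `B` and a point `b₀ ∈ H₀ ∖ 0`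
  obtain ⟨H₀, hH₀, h0⟩ : ∃ H₀ : Finset B, (∀ b, b ∈ H₀ ↔ c + b ∉ H₀) ∧ (0 : B) ∈ H₀ := by
    obtain ⟨H, hH⟩ := TwoHalves.exists_half c hc0 hcc
    by_cases h : (0 : B) ∈ H
    · exact ⟨H, hH, h⟩
    · refine ⟨H ∆ {0, c + 0}, TwoHalves.flip_cm H c hcc hH 0, ?_⟩
      rw [Finset.mem_symmDiff]
      exact Or.inr ⟨by simp, h⟩
  obtain ⟨b₀, hb₀, hb₀0⟩ : ∃ b₀ ∈ H₀, b₀ ≠ 0 := by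
    have hlt : ({0, c} : Finset B).card < (Finset.univ : Finset B).card := by
      rw [Finset.card_univ]; exact lt_of_le_of_lt Finset.card_le_two hB
    obtain ⟨b, -, hb⟩ := Finset.exists_mem_notMem_of_card_lt_card hlt
    simp only [Finset.mem_insert, Finset.mem_singleton, not_or] at hb
    by_cases hbH : b ∈ H₀
    · exact ⟨b, hbH, hb.1⟩
    · refine ⟨c + b, (hH₀ (c + b)).2 (by rwa [← add_assoc, hcc, zero_add]), fun h => hb.2 ?_⟩
      have e : b = -c := eq_neg_of_add_eq_zero_right h
      rwa [neg_eq_of_add_eq_zero_right hcc] at e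
  -- the graded half
  set S : Finset (Multiplicative B × Multiplicative (ZMod n)) := Finset.univ.filter fun w =>
    (if Multiplicative.toAdd w.1 ∈ H₀ then
        (if Multiplicative.toAdd w.1 = 0 then Multiplicative.toAdd w.2 = 0
          else (Multiplicative.toAdd w.2 = 0 ∨ Multiplicative.toAdd w.2 = 1 ∨ Multiplicative.toAdd w.2 = 3))
      else (if Multiplicative.toAdd w.1 = c then ¬ Multiplicative.toAdd w.2 = 0
        else ¬ (Multiplicative.toAdd w.2 = 0 ∨ Multiplicative.toAdd w.2 = 1 ∨ Multiplicative.toAdd w.2 = 3))) with hS_def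
  have hSmem : ∀ (b : B) (z : ZMod n), (Multiplicative.ofAdd b, Multiplicative.ofAdd z) ∈ S ↔
      (if b ∈ H₀ then (if b = 0 then z = 0 else (z = 0 ∨ z = 1 ∨ z = 3))
        else (if b = c then ¬ z = 0 else ¬ (z = 0 ∨ z = 1 ∨ z = 3))) := fun b z => by
    simp only [hS_def, Finset.mem_filter, Finset.mem_univ, true_and, toAdd_ofAdd]
  have hS : ∀ a, a ∈ S ↔ cA * a ∉ S := fun a => graded_cm H₀ c S hH₀ h0 hSmem hcc a
  have haper : ∀ a : Multiplicative B × Multiplicative (ZMod n), a ≠ 1 → ∃ s, ¬ (s ∈ S ↔ a * s ∈ S) := by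
    rintro ⟨av, aw⟩ ha
    have ha' : (Multiplicative.toAdd av, Multiplicative.toAdd aw) ≠ (0 : B × ZMod n) := by
      intro h
      apply ha
      rw [Prod.mk_eq_zero] at h
      exact Prod.ext (toAdd_eq_zero.1 h.1) (toAdd_eq_zero.1 h.2)
    have e1 : ((av, aw) : Multiplicative B × Multiplicative (ZMod n)) =
        (Multiplicative.ofAdd (Multiplicative.toAdd av), Multiplicative.ofAdd (Multiplicative.toAdd aw)) := by
      rw [ofAdd_toAdd, ofAdd_toAdd]
    rw [e1]
    exact graded_aperiodic H₀ c S hH₀ h0 hSmem hn _ _ ha'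
  have hasym : ∀ a : Multiplicative B × Multiplicative (ZMod n), ∃ s, ¬ (s ∈ S ↔ a * θA s ∈ S) := by
    rintro ⟨av, aw⟩
    have e1 : ((av, aw) : Multiplicative B × Multiplicative (ZMod n)) =
        (Multiplicative.ofAdd (Multiplicative.toAdd av), Multiplicative.ofAdd (Multiplicative.toAdd aw)) := by
      rw [ofAdd_toAdd, ofAdd_toAdd]
    obtain ⟨s, hs⟩ := graded_asymmetric H₀ c S hH₀ h0 hSmem hn θ (map_zero θ) hθc θ.injective hb₀ hb₀0
      (Multiplicative.toAdd av) (Multiplicative.toAdd aw)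
    refine ⟨s, ?_⟩
    rw [hθA_apply, e1]
    exact hs
  exact exists_simple_degenerate_of_index_two_doubled e i hi x hx hcov θA hθ' q hq hcq hccA hθAc hc S hS haper hasym

end Field

end Summit.HodgeConjecture.CorCM.SplitInvolution

end
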